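import Mathlib
import Summits.KontsevichZagierPeriods.Zeta5Search.Certificates.RecordRayWindow
import Summits.KontsevichZagierPeriods.Zeta5Search.Certificates.RayC1Chain
import Summits.KontsevichZagierPeriods.Zeta5Search.Certificates.RayC1Mirror
import Summits.KontsevichZagierPeriods.Zeta5Search.Certificates.RayC1AperyRho
import Summits.KontsevichZagierPeriods.Zeta5Search.Certificates.RayC1KernelBase
import HarnessLib

/-!
# Clause (N), window form, on the calibration ray C1: the forms are nonzero for infinitely many `n` (fam-tele g17, S4-C1 LITE file L5)

(g21 re-stage of the g17 bytes: the frame dictionary is imported from cert-1 g7's `RayC1AperyRho` instead of restated;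
g22: the conclusion of `Pgen_map_real` is written `Pgen ((q : ℚ) : ℝ)` — the same elaborated statement — so that its
text is not identified with the record's `RecordRayWindow.Pgen_map_real`, a lemma about a DIFFERENT constant `Pgen`
that merely prints alike.)

HONEST FRAMING: systematic search; no irrationality claim unless certified.  This file proves that the linear forms
`L_n = c1Form n = Q_n ζ(5) − P_n` (`RayC1Forms.c1Form_eq`) of Brown–Zudilin's cellular integral along the CALIBRATION ray
`a·n`, `a = (18,32,23,30,28,38,43,30)`, are NONZERO FOR INFINITELY MANY `n` — and nothing more: no size statement, no
denominator statement, NO claim about the arithmetic nature of `ζ(5)`; every exponent attached to C1 in the tree is `< 1`.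

**Theorem (`c1Form_frequently_ne_zero`).** `∃ᶠ n, c1Form n ≠ 0`.

Proof — the C1 copy of `RecordRayWindow`: `frequently_ne_zero_of_window'` (record file, generic) needs invertible real
frames (`RayC1Chain.realFrame_bC1_det_ne`), the chain rule `T_ℝ(b_{n+1}) = c_n • P̃(n) • T_ℝ(b_n)` with `c_n ≠ 0`
(`RayC1Chain.realFrame_chain`, `cRec_ne`), `L_n = −ρ_n · adj(T_ℝ(b_n))₀₂` (`RayC1AperyRho.c1Form_eq_realAdjugate`,
cert-1 g7; `rhoOf_aC1_ne_zero` from `RayC1KernelBase`), and a window determinant `D(n)` of `(P̃(n), P̃(n+1))` nonzero for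
infinitely many `n`: `Pgen` commutes with ring maps (`RayC1GenericSteps.map_Pgen`), so `D(n) ∈ ℤ` reduces mod 193 to
`D(n mod 193)`, and `D(1) = 94 ≠ 0` in `ℤ/193` by the kernel computation `RayC1Mirror.DwinM_mod193`; hence `D(n) ≠ 0`
for all `n ≡ 1 (mod 193)`.
Decl names follow `RecordRayWindow` inside `…RayC1.Generic` (generic lemmas `toMatrix_windowM`, `map_windowMat`,
`frequently_ne_zero_of_window'` are imported by name).
-/

namespace Summit.KontsevichZagierPeriods.Zeta5Search.RayC1.Generic

open Matrix Filter
open Summit.KontsevichZagierPeriods.Zeta5Search.WedgeDictionary (rhoOf)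
open Summit.KontsevichZagierPeriods.Zeta5Search.RecordRay.Connection
open Summit.KontsevichZagierPeriods.Zeta5Search.RecordRay.Generic (M3 windowM toMatrix_windowM map_windowMat
  frequently_ne_zero_of_window')

/-! ### 1. The window determinant of the C1 ray, generically, and its naturality -/

section Generic

variable {R S : Type*} [CommRing R] [CommRing S] (f : R →+* S)

/-- The window determinant `D(ν)` of the C1 period matrices `(P̃(ν), P̃(ν+1))`. -/
noncomputable def Dwin (ν : R) : R := (windowMat (Pgen ν) (Pgen (ν + 1))).det

/-- The mirror computes `D`. -/
theorem DwinM_eq (ν : R) : DwinM ν = Dwin ν := by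
  rw [DwinM, Dwin, ← M3.det_toMatrix, toMatrix_windowM, toMatrix_PgenM, toMatrix_PgenM]

/-- `D` commutes with ring maps (it is a fixed integer polynomial in `ν`). -/
theorem map_Dwin (ν : R) : f (Dwin ν) = Dwin (f ν) := by
  rw [Dwin, Dwin, RingHom.map_det, map_windowMat, map_Pgen, map_Pgen, map_add, map_one]

end Generic

/-! ### 2. `D(n) ≠ 0` for `n ≡ 1 (mod 193)` -/

/-- A nonzero value of the window determinant in `ZMod 193` lifts: `Dwin ν ≠ 0` in characteristic `0` on that residue class. -/
theorem Dwin_ne_of_mod {n : ℕ} (h : (n : ZMod 193) = 1) : Dwin (n : ℚ) ≠ 0 := by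
  intro h0
  have hZ : Dwin (n : ℤ) = 0 := by
    have e := map_Dwin (Int.castRingHom ℚ) (n : ℤ)
    rw [eq_intCast, eq_intCast, Int.cast_natCast, h0] at e
    exact_mod_cast e
  have e2 := map_Dwin (Int.castRingHom (ZMod 193)) (n : ℤ)
  rw [hZ, map_zero, eq_intCast, Int.cast_natCast, h, ← DwinM_eq] at e2
  exact DwinM_mod193 e2.symm

/-- The window determinant of the C1 ray is nonzero for infinitely many `ν` (the residue class of `1 mod 193`). -/
theorem Dwin_frequently_ne : ∃ᶠ n : ℕ in atTop, Dwin (n : ℚ) ≠ 0 := by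
  refine Filter.frequently_atTop.2 fun N => ⟨193 * N + 1, by omega, Dwin_ne_of_mod ?_⟩
  have h193 : ((193 : ℕ) : ZMod 193) = 0 := ZMod.natCast_self 193
  rw [Nat.cast_add, Nat.cast_mul, h193, zero_mul, zero_add, Nat.cast_one]

/-- The real connection matrix is the cast of the rational one (C1's `Pgen`; the cast on the right is spelled
`((q : ℚ) : ℝ)` — the same elaborated statement as in the g17/g21 bytes, so every `rw [Pgen_map_real]` caller is
unchanged). -/
theorem Pgen_map_real (q : ℚ) : (Pgen q).map ((↑) : ℚ → ℝ) = Pgen ((q : ℚ) : ℝ) := by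
  have e := map_Pgen (Rat.castHom ℝ) q
  rwa [RingHom.mapMatrix_apply, Rat.coe_castHom] at e

/-- The real window determinant is the cast of the rational one. -/
theorem Dwin_real (q : ℚ) : ((Dwin q : ℚ) : ℝ) = Dwin (q : ℝ) := by
  have e := map_Dwin (Rat.castHom ℝ) q
  rwa [Rat.coe_castHom] at e

/-! ### 3. The C1 form as an adjugate entry of the real frame

`c1Form n = −ρ_n · adj(T_ℝ(b_n))₀₂` (definitional, no convergence needed) and `b′_n = bump b_n 6` are the landed
`RayC1AperyRho.c1Form_eq_realAdjugate` / `RayC1AperyRho.bC1'_eq_bump` (cert-1 g7, namespace `…RayC1`), used below by name —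
not restated here (g21 re-stage; the g17 bytes carried verbatim copies `c1Form_eq_adjugate` / `bC1'_eq_bump`). -/

/-! ### 4. Clause (N), window form, on C1 -/

/-- **(N∃ᶠ) for the calibration ray C1.**  The linear forms `L_n = Q_n ζ(5) − P_n` of Brown–Zudilin's cellular integral
along `a·n`, `a = (18,32,23,30,28,38,43,30)`, are nonzero for infinitely many `n` (indeed for some `n` in every window
`{m, m+1, m+2}`, `m ≡ 1 (193)`).  HONEST FRAMING: this is NOT an irrationality statement. -/
theorem c1Form_frequently_ne_zero : ∃ᶠ n in Filter.atTop, c1Form n ≠ 0 := by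
  refine frequently_ne_zero_of_window' c1Form (fun n => realFrame (bC1 n))
    (fun n => (Pgen (n : ℚ)).map ((↑) : ℚ → ℝ)) (fun n => (cRec n : ℝ)) (fun n => -(rhoOf (aC1 n) : ℝ)) 1
    (fun n hn => realFrame_bC1_det_ne hn) (fun n hn => by exact_mod_cast cRec_ne hn)
    (fun n _ => neg_ne_zero.2 (by exact_mod_cast rhoOf_aC1_ne_zero n)) (fun n hn => realFrame_chain hn)
    (fun n _ => by rw [c1Form_eq_realAdjugate, neg_mul]) ?_
  refine Dwin_frequently_ne.mono fun n hn => ?_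
  have h' : Dwin (n : ℝ) ≠ 0 := by
    have := (Rat.cast_ne_zero (α := ℝ)).2 hn
    rwa [Dwin_real, Rat.cast_natCast] at this
  show (windowMat ((Pgen (n : ℚ)).map ((↑) : ℚ → ℝ)) ((Pgen ((n + 1 : ℕ) : ℚ)).map ((↑) : ℚ → ℝ))).det ≠ 0
  rw [Pgen_map_real, Pgen_map_real]
  push_cast
  exact h'

/-- The same in the shape of clause (N): `Q_n ζ(5) − P_n ≠ 0` for infinitely many `n`, on the C1 ray. -/
theorem c1Pair_frequently_ne_zero :
    ∃ᶠ n in Filter.atTop, (c1Q n : ℝ) * Literature.NumberTheory.Transcendental.zetaValue 5 - (c1P n : ℝ) ≠ 0 := by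
  refine (c1Form_frequently_ne_zero.and_eventually (Filter.eventually_ge_atTop 1)).mono fun n hn => ?_
  rw [← c1Form_eq hn.2]
  exact hn.1

end Summit.KontsevichZagierPeriods.Zeta5Search.RayC1.Generic
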